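import Summits.ABC.IUTFork.Thm311RealInd1UnitsHNTransvection
import HarnessLib

/-!
# The unit-group shear at `v₇ = (√7)` of `ℚ(√7)`, VII: the HOSHI–NISHIO DICHOTOMY — `baseSeg`
# always moves, `μ·U^{(2)}` moves iff the print-unpinned scalar has `‖c‖ > 1`

Record file (D-0012) of the abc-iut cell (TEAM R, lead seat abc-iut-c312-14 = R1, gen 9; row
«R9f-HN-UNIPOTENT», claimed plan/C312-TEAMS.md 2026-08-27T00:29:30Z), file 2 of 2 — the sequel of
`Thm311RealInd1UnitsHNTransvection.lean` (which carries the family `hnLin c`, its print-shape laws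
and the NORMAL FORM; full background and the item-map locators are in ITS header).  TAKES NO SIDE
on [IUTchIII] Cor. 3.12.

CONTENT — the step-(ii) adjudication of GAP row G-c312-14-R9f on the family:

* `psiHN c` — the realisation `ψ_c = e₇⁻¹ ∘ T_c ∘ e₇` on `K_{v₇}` (mirror of `psiShear`), with
  inverse `ψ_{−c}` and continuity;
* `psiHN_moves_baseSeg` — EVERY `c ≠ 0` moves the base-line target `baseSeg` (kernel mirror of
  [HN] Lem 2.4: never `(ℚ_{p_k})_+`-characteristic at `d = 2`);
* **`psiHN_image_M2_iff`** — THE DICHOTOMY: `ψ_c` fixes the landed `μ·U^{(2)}`-target `M₂` iff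
  `‖c‖ ≤ 1` (parity threshold via `IsmDHMover.norm_padic_le_zpow_iff`); hence
  `hn_family_M2_dichotomy`: BOTH horns are realised inside the print-allowed family (`c = 1`
  preserves, `c = 7⁻¹` moves) — whether Hoshi–Nishio's `*α` moves `μ·U^{(2)}` is exactly the
  valuation of its shear scalar, a datum [HN] Thm 1.5 + Lem 2.3/2.4 leave free: abc-iut-lit
  gen 10's «undecided by the held text», as a kernel statement;
* `exists_pow_psiHN_image_M2_eq` — the `p^m`-tail (high `p`-divisibility members fix any target);
* `print_shape_adjudication` — packaged: every print-shaped `T` is `hnLin c`, `c ≠ 0`, moves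
  `baseSeg`, and fixes `M₂` iff `‖c‖ ≤ 1`;
* strip wiring (hypotheses INLINE per D-0067, no new Prop facts): `psiHN_mem_ind1StripOf`,
  `ind1_strip_moves_baseSeg_of_hnRealised`, `ind1_strip_moves_M2_of_hnRealised`.

[cite: HoshiNishio2022OuterAutMLF, Thm 1.5 p.5 l.25–31; Lem 2.3 (ii) p.7 l.21–33; Lem 2.4 p.8
l.22–24 (RIMS-1931 rev.)] [cite: MochizukiAbsAnab2004, Prop 1.2.1 (iii) p.10]
[claim: Mochizuki2012, status: disputed] for every [IUTchIII] locution.  Consumed BY NAME, nothing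
restated: the UnitsShear chain (R1 g7/g8/g9), `IsmDHMover.norm_padic_le_zpow_iff` (w5-d216),
`Realises`/`stripMulAut`/`ind1StripOf` (c312-1).  Nothing here asserts or refutes [IUTchIII]
Cor. 3.12; typed ≠ proved; cited ≠ endorsed.
-/

set_option autoImplicit false

noncomputable section

namespace Summit.ABC.IUTFork.Thm311.Real.UnitsShear

open Literature.IUT.LogVolume Literature.NumberTheory.NumberFields
open NumberField IsDedekindDomain Metric IsUltrametricDist
open Summit.ABC.IUTFork.RamifiedMover
open Summit.ABC.IUTFork.Thm311.Real

/-! ## 3. The realisation `ψ_c = e₇⁻¹ ∘ T_c ∘ e₇` on `K_{v₇}` -/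

/-- `T_c` as a linear equivalence (`T_c⁻¹ = T_{−c}`). [folklore] -/
def hnEquiv (c : ℚ_[7]) : K7 ≃ₗ[ℚ_[7]] K7 :=
  LinearEquiv.ofLinear (hnLin c) (hnLin (-c))
    (by rw [hnLin_comp, add_neg_cancel, hnLin_zero])
    (by rw [hnLin_comp, neg_add_cancel, hnLin_zero])

/-- `hnEquiv` applied. [folklore] -/
theorem hnEquiv_apply (c : ℚ_[7]) (x : K7) : hnEquiv c x = hnLin c x := rfl

/-- **The realisation of `T_c` on `K_{v₇}`** (mirror of `psiShear`): the bicontinuous additive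
automorphism `ψ_c = e₇⁻¹ ∘ T_c ∘ e₇`. [folklore] -/
def psiHN (c : ℚ_[7]) : v7.adicCompletion ↥F7 ≃+ v7.adicCompletion ↥F7 :=
  (e7.toAddEquiv.trans (hnEquiv c).toAddEquiv).trans e7.symm.toAddEquiv

/-- `ψ_c` applied. [folklore] -/
theorem psiHN_apply (c : ℚ_[7]) (x : v7.adicCompletion ↥F7) :
    psiHN c x = e7.symm (hnLin c (e7 x)) := rfl

/-- `ψ_c⁻¹` applied (`= ψ_{−c}`). [folklore] -/
theorem psiHN_symm_apply (c : ℚ_[7]) (x : v7.adicCompletion ↥F7) :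
    (psiHN c).symm x = e7.symm (hnLin (-c) (e7 x)) := rfl

/-- `ψ_c ∘ ψ_{−c} = id` (the one-parameter law at the completion). [folklore] -/
theorem psiHN_psiHN_neg (c : ℚ_[7]) (y : v7.adicCompletion ↥F7) :
    psiHN c (psiHN (-c) y) = y := by
  rw [psiHN_apply, psiHN_apply, e7.apply_symm_apply, hnLin_hnLin, add_neg_cancel, hnLin_zero,
    LinearMap.id_apply, e7.symm_apply_apply]

/-- `ψ_c` is continuous (finite dimension). [folklore] -/
theorem continuous_psiHN (c : ℚ_[7]) : Continuous ⇑(psiHN c) := by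
  haveI : FiniteDimensional ℚ_[7] K7 := Module.finite_of_finrank_eq_succ finrank_K7
  exact LinearMap.continuous_of_finiteDimensional ((hnEquiv c) : K7 →ₗ[ℚ_[7]] K7)

/-- `ψ_c⁻¹` is continuous. [folklore] -/
theorem continuous_psiHN_symm (c : ℚ_[7]) : Continuous ⇑(psiHN c).symm := by
  haveI : FiniteDimensional ℚ_[7] K7 := Module.finite_of_finrank_eq_succ finrank_K7
  exact LinearMap.continuous_of_finiteDimensional
    (((hnEquiv c).symm : K7 ≃ₗ[ℚ_[7]] K7) : K7 →ₗ[ℚ_[7]] K7)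

/-! ## 4. The dichotomy: `baseSeg` always moves, `M₂` moves iff `‖c‖ > 1` -/

/-- On the `μ·U^{(2)}`-ball, `T_c` stays in the ball when `‖c‖ ≤ 1`. [folklore] -/
theorem hnLin_mem_M2ball {c : ℚ_[7]} (hc : ‖c‖ ≤ 1) {z : K7} (hz : ‖z‖ ≤ ‖Omega‖ ^ 2) :
    ‖hnLin c z‖ ≤ ‖Omega‖ ^ 2 := by
  obtain ⟨h0, h1⟩ := norm_omega_pos_lt_one
  have ha : ‖bs7.repr z 0‖ ≤ ‖Omega‖ ^ 2 := by
    have h := norm_decomp z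
    rw [h] at hz
    exact le_trans (le_max_left _ _) hz
  rw [hnLin_apply]
  refine (norm_add_le_max _ _).trans (max_le hz ?_)
  rw [norm_smul, norm_mul]
  have h2 : ‖c‖ * ‖bs7.repr z 0‖ * ‖Omega‖ ≤ 1 * ‖Omega‖ ^ 2 * ‖Omega‖ := by gcongr
  have h3 : (1 : ℝ) * ‖Omega‖ ^ 2 * ‖Omega‖ ≤ ‖Omega‖ ^ 2 := by
    rw [one_mul]
    calc ‖Omega‖ ^ 2 * ‖Omega‖ ≤ ‖Omega‖ ^ 2 * 1 :=
          mul_le_mul_of_nonneg_left h1.le (by positivity)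
      _ = ‖Omega‖ ^ 2 := mul_one _
  exact h2.trans h3

/-- **`ψ_c` fixes the `μ·U^{(2)}`-target `M₂` whenever `‖c‖ ≤ 1`** — the small-scalar half of the
dichotomy. [claim: Mochizuki2012, status: disputed] -/
theorem psiHN_image_M2_of_le_one {c : ℚ_[7]} (hc : ‖c‖ ≤ 1) :
    ⇑(psiHN c) '' (M2 : Set (v7.adicCompletion ↥F7)) = M2 := by
  apply Set.Subset.antisymm
  · rintro y ⟨z, hz, rfl⟩
    rw [SetLike.mem_coe, mem_M2_iff] at hz ⊢
    rw [psiHN_apply, e7.apply_symm_apply]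
    exact hnLin_mem_M2ball hc hz
  · intro y hy
    refine ⟨psiHN (-c) y, ?_, psiHN_psiHN_neg c y⟩
    rw [SetLike.mem_coe, mem_M2_iff] at hy ⊢
    rw [psiHN_apply, e7.apply_symm_apply]
    exact hnLin_mem_M2ball (by rwa [norm_neg]) hy

/-- **`ψ_c` MOVES `M₂` whenever `1 < ‖c‖`** — the large-scalar half: `ψ_c(e₇⁻¹ 7) = e₇⁻¹(7 + 7c·Ω)`
escapes the ball (discreteness: `1 < ‖c‖` forces `‖Ω‖⁻¹ < ‖c‖`). [claim: Mochizuki2012, status: disputed] -/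
theorem psiHN_moves_M2_of_one_lt {c : ℚ_[7]} (hc : 1 < ‖c‖) :
    ⇑(psiHN c) '' (M2 : Set (v7.adicCompletion ↥F7)) ≠ M2 := by
  obtain ⟨h0, h1⟩ := norm_omega_pos_lt_one
  intro hEq
  have h7m : e7.symm (7 : K7) ∈ M2 := by
    rw [mem_M2_iff, e7.apply_symm_apply, norm_seven_K7]
  have hmem : psiHN c (e7.symm (7 : K7)) ∈ ⇑(psiHN c) '' (M2 : Set (v7.adicCompletion ↥F7)) :=
    ⟨e7.symm (7 : K7), h7m, rfl⟩
  rw [hEq, SetLike.mem_coe, mem_M2_iff, psiHN_apply, e7.apply_symm_apply, e7.apply_symm_apply,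
    hnLin_apply, repr_seven.1] at hmem
  have hr1 : bs7.repr ((7 : K7) + (c * 7) • Omega) 1 = c * 7 := by
    rw [map_add, Finsupp.add_apply, repr_seven.2, (repr_smul_omega _).2, zero_add]
  rw [norm_decomp, hr1] at hmem
  have hble : ‖c * (7 : ℚ_[7])‖ * ‖Omega‖ ≤ ‖Omega‖ ^ 2 := le_trans (le_max_right _ _) hmem
  rw [norm_mul, norm_seven_q7, ← norm_omega_sq] at hble
  -- discreteness: `1 < ‖c‖` forces `‖Ω‖⁻¹ < ‖c‖` (no even power of `‖Ω‖` strictly between).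
  have hcgt : ‖Omega‖⁻¹ < ‖c‖ := by
    by_contra hle
    have hle' : ‖c‖ ≤ ‖Omega‖⁻¹ := not_lt.mp hle
    have h7 : ‖c‖ ≤ ‖Omega‖ ^ (2 * (0 : ℤ) - 1) := by
      rw [show (2 * (0 : ℤ) - 1) = -1 by norm_num, zpow_neg_one]
      exact hle'
    have h8 := (IsmDHMover.norm_padic_le_zpow_iff norm_omega_sq c 0).mp h7
    rw [show (2 * (0 : ℤ)) = 0 by norm_num, zpow_zero] at h8
    exact absurd h8 (not_le.mpr hc)
  have hpos : (0 : ℝ) < ‖Omega‖ ^ 2 * ‖Omega‖ := by positivity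
  have h4 : ‖Omega‖⁻¹ * (‖Omega‖ ^ 2 * ‖Omega‖) < ‖c‖ * (‖Omega‖ ^ 2 * ‖Omega‖) :=
    mul_lt_mul_of_pos_right hcgt hpos
  have h5 : ‖Omega‖⁻¹ * (‖Omega‖ ^ 2 * ‖Omega‖) = ‖Omega‖ ^ 2 := by
    rw [mul_comm (‖Omega‖ ^ 2) ‖Omega‖, ← mul_assoc, inv_mul_cancel₀ h0.ne', one_mul]
  rw [h5] at h4
  nlinarith

/-- **THE DICHOTOMY (step (ii) of GAP row G-c312-14-R9f, adjudicated on the family)**: `ψ_c` fixes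
the landed `μ·U^{(2)}`-target iff `‖c‖ ≤ 1` — the question «does the Hoshi–Nishio automorphism
move `μ·U^{(2)}`?» IS the question «is the valuation of its shear scalar negative?», and THAT
scalar the print does not pin. [cite: HoshiNishio2022OuterAutMLF, Thm 1.5]
[claim: Mochizuki2012, status: disputed] -/
theorem psiHN_image_M2_iff (c : ℚ_[7]) :
    ⇑(psiHN c) '' (M2 : Set (v7.adicCompletion ↥F7)) = M2 ↔ ‖c‖ ≤ 1 := by
  constructor
  · intro h
    by_contra hgt
    exact psiHN_moves_M2_of_one_lt (not_le.mp hgt) h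
  · exact psiHN_image_M2_of_le_one

/-- **`ψ_c` moves the base-line target `baseSeg` for EVERY `c ≠ 0`** — the kernel mirror of [HN]
Lem 2.4 (`*α^n` never `(ℚ_{p_k})_+`-characteristic at `d = 2`): the base-line answer is UNIFORM
across the family, unlike the `μ·U^{(2)}` answer. [cite: HoshiNishio2022OuterAutMLF, Lem 2.4 p.8
l.22–24] -/
theorem psiHN_moves_baseSeg {c : ℚ_[7]} (hc : c ≠ 0) :
    ⇑(psiHN c) '' (baseSeg : Set (v7.adicCompletion ↥F7)) ≠ baseSeg := by
  obtain ⟨h0, h1⟩ := norm_omega_pos_lt_one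
  intro hEq
  have h7m : e7.symm (7 : K7) ∈ baseSeg := by
    rw [mem_baseSeg_iff, e7.apply_symm_apply]
    refine ⟨repr_seven.2, ?_⟩
    rw [norm_seven_K7]
    nlinarith
  have hmem : psiHN c (e7.symm (7 : K7)) ∈
      ⇑(psiHN c) '' (baseSeg : Set (v7.adicCompletion ↥F7)) :=
    ⟨e7.symm (7 : K7), h7m, rfl⟩
  rw [hEq, SetLike.mem_coe, mem_baseSeg_iff, psiHN_apply, e7.apply_symm_apply,
    e7.apply_symm_apply, hnLin_apply, repr_seven.1] at hmem
  have hco := hmem.1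
  rw [map_add, Finsupp.add_apply, repr_seven.2, (repr_smul_omega _).2, zero_add] at hco
  rcases mul_eq_zero.mp hco with h | h
  · exact hc h
  · exact (by norm_num : (7 : ℚ_[7]) ≠ 0) h

/-! ## 5. Both horns realised; the `p^m`-tail; the packaged adjudication -/

/-- **BOTH HORNS OF THE `μ·U^{(2)}` QUESTION ARE REALISED INSIDE THE PRINT-ALLOWED FAMILY**:
`c = 1` (norm `1`) fixes `M₂`, `c = 7⁻¹` (norm `7`) moves it — the data [HN] Thm 1.5 +
Lem 2.3/2.4 pin (unipotent, `Ker Tr` fixed, base line moved, `c ≠ 0`) decide NEITHER horn: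
abc-iut-lit gen 10's «undecided by the held text», as a kernel statement.
[cite: HoshiNishio2022OuterAutMLF, Thm 1.5] [claim: Mochizuki2012, status: disputed] -/
theorem hn_family_M2_dichotomy :
    (∃ c : ℚ_[7], c ≠ 0 ∧ ⇑(psiHN c) '' (M2 : Set (v7.adicCompletion ↥F7)) = M2) ∧
      ∃ c : ℚ_[7], c ≠ 0 ∧ ⇑(psiHN c) '' (M2 : Set (v7.adicCompletion ↥F7)) ≠ M2 := by
  refine ⟨⟨1, one_ne_zero, psiHN_image_M2_of_le_one (by rw [norm_one])⟩,
    ⟨(7 : ℚ_[7])⁻¹, inv_ne_zero (by norm_num), psiHN_moves_M2_of_one_lt ?_⟩⟩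
  rw [norm_inv, norm_seven_q7, inv_inv]
  norm_num

/-- **The `p^m`-divisibility tail**: for every scalar `c` there is `m` with `7^m ∣ n ⟹ ψ_{n·c}`
fixes `M₂` — print's «`*α^n` at high `p`-divisibility preserves any fixed lattice» (the family
always CONTAINS members idle on `μ·U^{(2)}`; only the minimal valuation, not the family, can
decide the mover question). [folklore] -/
theorem exists_pow_psiHN_image_M2_eq (c : ℚ_[7]) :
    ∃ m : ℕ, ∀ n : ℤ, ((7 : ℤ) ^ m ∣ n) →
      ⇑(psiHN ((n : ℚ_[7]) * c)) '' (M2 : Set (v7.adicCompletion ↥F7)) = M2 := by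
  obtain ⟨m, hm⟩ := pow_unbounded_of_one_lt ‖c‖ (by norm_num : (1 : ℝ) < 7)
  refine ⟨m, fun n hn => psiHN_image_M2_of_le_one ?_⟩
  obtain ⟨k, rfl⟩ := hn
  have hcast : (((7 : ℤ) ^ m * k : ℤ) : ℚ_[7]) = (7 : ℚ_[7]) ^ m * (k : ℚ_[7]) := by
    push_cast
    ring
  rw [hcast, mul_assoc, norm_mul, norm_pow, norm_seven_q7]
  have hk : ‖(k : ℚ_[7])‖ ≤ 1 := Padic.norm_int_le_one k
  have h7 : ((7 : ℕ) : ℝ) = (7 : ℝ) := by norm_num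
  rw [h7]
  have hnk : ‖(k : ℚ_[7]) * c‖ ≤ 1 * (7 : ℝ) ^ m := by
    rw [norm_mul]
    exact mul_le_mul hk hm.le (norm_nonneg _) zero_le_one
  calc ((7 : ℝ)⁻¹) ^ m * ‖(k : ℚ_[7]) * c‖
      ≤ ((7 : ℝ)⁻¹) ^ m * (1 * (7 : ℝ) ^ m) :=
        mul_le_mul_of_nonneg_left hnk (by positivity)
    _ = 1 := by
        rw [one_mul, ← mul_pow, inv_mul_cancel₀ (by norm_num : (7 : ℝ) ≠ 0), one_pow]

/-- **THE PACKAGED STEP-(ii) ADJUDICATION**: every endomorphism of `K₇` with the print shape —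
unipotent with `(T − id)² = 0` ([HN] Thm 1.5), `Ker Tr`-line invariant ([HN] Lem 2.3 (ii)),
`≠ id` — IS `hnLin c` for a (unique) `c ≠ 0`; its realisation on `K_{v₇}` MOVES the base-line
target `baseSeg` ([HN] Lem 2.4 in kernel form), and it fixes the `μ·U^{(2)}`-target `M₂` **iff**
`‖c‖ ≤ 1` — a datum the held text leaves free in both directions (`hn_family_M2_dichotomy`).
GAP row G-c312-14-R9f step (ii) is hereby reduced to the valuation of the one print-unpinned
scalar. [cite: HoshiNishio2022OuterAutMLF, Thm 1.5; Lem 2.3 (ii); Lem 2.4]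
[claim: Mochizuki2012, status: disputed] -/
theorem print_shape_adjudication {T : K7 →ₗ[ℚ_[7]] K7}
    (hunip : (T - LinearMap.id) ∘ₗ (T - LinearMap.id) = 0)
    (hne : T ≠ LinearMap.id)
    (hline : ∃ s : ℚ_[7], T Omega = s • Omega) :
    ∃ c : ℚ_[7], c ≠ 0 ∧ T = hnLin c ∧
      ⇑(psiHN c) '' (baseSeg : Set (v7.adicCompletion ↥F7)) ≠ baseSeg ∧
      (⇑(psiHN c) '' (M2 : Set (v7.adicCompletion ↥F7)) = M2 ↔ ‖c‖ ≤ 1) := by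
  obtain ⟨c, hT⟩ := eq_hnLin_of_unipotent_of_line hunip hline
  have hc : c ≠ 0 := by
    intro h
    exact hne (by rw [hT, h, hnLin_zero])
  exact ⟨c, hc, hT, psiHN_moves_baseSeg hc, psiHN_image_M2_iff c⟩

/-! ## 6. Strip wiring: the conditional (Ind1)-movers with the HN-realisation hypothesis inline -/

/-- Under the HN-realisation hypothesis, `ψ_c` is in print's (Ind1) strip part at `v₇`.
[claim: Mochizuki2012, status: disputed] -/
theorem psiHN_mem_ind1StripOf {φ : Gal v7 ≃ₜ* Gal v7} {c : ℚ_[7]}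
    (hφ : Realises v7 L7 (stripMulAut v7 φ) (psiHN c)) :
    psiHN c ∈ ind1StripOf v7 L7 :=
  ⟨continuous_psiHN c, continuous_psiHN_symm c, φ, hφ⟩

/-- **The HN-reading (Ind1) BASE-LINE mover** (hypothesis INLINE per D-0067): if some
`φ ∈ Aut_top(G_{v₇})` realises ANY nonzero member of the unipotent family through `L₇` — the
tree reading of «`*α_+` is the Thm 1.5 transvection» — then print's (Ind1) strip part at `v₇`
moves `baseSeg`.  Unconditional on the scalar: [HN] Lem 2.4's conclusion holds for every `c ≠ 0`.
[cite: HoshiNishio2022OuterAutMLF, Thm 1.5; Lem 2.4] [claim: Mochizuki2012, status: disputed] -/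
theorem ind1_strip_moves_baseSeg_of_hnRealised
    (h : ∃ (φ : Gal v7 ≃ₜ* Gal v7) (c : ℚ_[7]), c ≠ 0 ∧
        Realises v7 L7 (stripMulAut v7 φ) (psiHN c)) :
    ∃ ψ ∈ ind1StripOf v7 L7,
      ⇑ψ '' (baseSeg : Set (v7.adicCompletion ↥F7)) ≠ baseSeg := by
  obtain ⟨φ, c, hc, hφ⟩ := h
  exact ⟨psiHN c, psiHN_mem_ind1StripOf hφ, psiHN_moves_baseSeg hc⟩

/-- **The HN-reading (Ind1) `μ·U^{(2)}`-mover** (hypothesis INLINE per D-0067): a realised member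
with `1 < ‖c‖` makes print's (Ind1) strip part move the ideal-shaped target `M₂`.  The scalar
hypothesis is NOT dischargeable from the held text (`hn_family_M2_dichotomy`): it is the residual
datum of GAP row G-c312-14-R9f step (ii). [claim: Mochizuki2012, status: disputed] -/
theorem ind1_strip_moves_M2_of_hnRealised
    (h : ∃ (φ : Gal v7 ≃ₜ* Gal v7) (c : ℚ_[7]), 1 < ‖c‖ ∧
        Realises v7 L7 (stripMulAut v7 φ) (psiHN c)) :
    ∃ ψ ∈ ind1StripOf v7 L7,
      ⇑ψ '' (M2 : Set (v7.adicCompletion ↥F7)) ≠ M2 := by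
  obtain ⟨φ, c, hc, hφ⟩ := h
  exact ⟨psiHN c, psiHN_mem_ind1StripOf hφ, psiHN_moves_M2_of_one_lt hc⟩

end Summit.ABC.IUTFork.Thm311.Real.UnitsShear

end
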